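import Literature.AnabelianGeometry.EtaleTheta.ThetaCoversMonodromyModelTempered
import HarnessLib

/-!
# The MONODROMY MODEL of the tempered theta-covering interface ([EtTh] §2), part 4: the members of the tower in
# coordinates and a family of automorphisms of `Π^tp_C = TG l`

S. Mochizuki, *The étale theta function and its Frobenioid-theoretic manifestations* [EtTh], Publ. RIMS **45**
(2009), §2 Prop. 2.4 (PDF p. 38), Def. 2.5 (p. 39), Prop. 2.6 and Rmk. 2.6.1 (p. 40) [cite: MochizukiEtTh2009, Prop 2.6 p.40]
[cite: MochizukiEtTh2009, Rmk 2.6.1 p.40].  Cell abc-iut, layer L2, seat abc-iut-w6-d084 (gen 7), «P26-NV MONODROMY TOY»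
(abc-iut-L2-lead R1352 GO STAGED; this file prepares the CHECKPOINT «automorphism census»).  Sequel of parts 1–3
(`ThetaCoversMonodromyModelDefs/Theta/Tempered.lean`: `TG l = ((ℤ/l × ℤ/l) ⋊ D_∞) × ℤ/2`, `Φ`, `monodromyModel l hl`).
DEF-BEARING (class (b) MODEL/CONSTRUCTION file: the automorphisms are data; no frozen structure touched).

HONEST LABEL (R1352): a DESIGNED tempered toy with print's monodromy combinatorics — loop ↦ `Δ̄^ell` (`b`-cycle), the
inversion INVERTS it, unipotent monodromy `x ↦ x·z` on the `a`-cycle, `z` = cusp inertia = `Δ̄_Θ` central;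
`G_K := 1`; NOT a Tate curve, NOT the tempered fundamental group of a curve; consistency ≠ faithfulness; nothing here
takes a side on anything printed.

CONTENT (coordinates `g = ((v, d), e)`, `v = (b, c) ∈ (ℤ/l)²`, `d ∈ D_∞`, `e ∈ ℤ/2`).  §1 The members of the towers of
Prop. 2.4 / Def. 2.5 (ii) at `T := monodromyModel l hl`: `Π^tp_X = {d rotation}`, `Π^tp_{C̲̲} = {b = c = 0}`
(`Π_{C̲̲} = Φ⁻¹(D_l)`), `Π^tp_{X̲̲} = {b = c = 0, d rotation}`, `Π^tp_{C̲} = {b = 0}`, `Π^tp_{X̲} = {b = 0, d rotation}`,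
`Π^tp_Ċ = {e = 1}`, `Π^tp_Ÿ = {d = 1, e = 1}` — so `Π^tp_{Ẋ̲̲} ≅ ℤ = ⟨t⟩`, `Π^tp_{Ẋ̲} ≅ ℤ/l × ℤ`, `Π^tp_{Ċ̲̲} ≅ D_∞`,
`Π^tp_{Ċ̲} ≅ ℤ/l × D_∞` (Rmk. 2.6.1's shape: «direct product with `Gal(Ċ/C)`» becomes, undotted, `× ⟨e⟩`).  §2 Automorphisms
of `TG l` beyond the inner ones: `scaleAut u` (`(b, c) ↦ (ub, uc)`, `u ∈ (ℤ/l)ˣ` — acts on `Δ̄_Θ = ⟨z⟩` by `u`),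
`halfShift k` (`sr i ↦ sr (i + k)` on `D_∞` with the compensating shear `(b, c) ↦ (b, c − (k/2) b)`; for odd `k` this
is «conjugation by `t^{k/2}`», which exists only in the profinite completion), `sheetTwist χ` (`e ↦ e · χ(v, d)` for a
character `χ` of `(ℤ/l × ℤ/l) ⋊ D_∞`, e.g. the rotation parity `t ↦ e t` or the reflection parity `ι ↦ e ι`).  The sequel
(STAGE 2) proves that every topological automorphism of each dotted member is a restriction of a composite of these and
inner automorphisms stabilising the printed lists — the typed Prop. 2.6 (and Prop. 2.4) AT THE MODEL.
-/

noncomputable section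

namespace Literature.AnabelianGeometry.EtaleTheta.ThetaCovers.MonodromyModel

open Multiplicative HeisenbergWitness TemperedModel Literature.AnabelianGeometry.SemiGraphs

variable (l : ℕ)

/-! ## 1. The members of the tower in coordinates -/

section Members

variable [NeZero l]

/-- `Π_{C̲̲} = Φ⁻¹(D_l)`: the Def. 2.3 subgroup `(Ker Φ ⊔ Φ⁻¹⟨r⟩) ⊔ ⟨ι⟩` is the preimage of `heisD = inr(D_l)`.
(toy bookkeeping for the typed interface of [EtTh] Def. 2.3; no claim about print) [cite: MochizukiEtTh2009, Def 2.3 p.38] -/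
theorem PiCuuM_eq : PiCuuM l = (heisD l).comap (Phi l) := by
  refine le_antisymm (sup_le (sup_le (Subgroup.comap_mono bot_le) (Subgroup.comap_mono inf_le_left)) ?_) ?_
  · rw [Subgroup.zpowers_le, Subgroup.mem_comap, Phi_iotaM]
    exact inr_mem_heisD l _
  · intro x hx
    rw [Subgroup.mem_comap, mem_heisD] at hx
    rcases hd : (Phi l x).right with i | i
    · refine Subgroup.mem_sup_left (Subgroup.mem_sup_right ?_)
      exact ⟨hx, (mem_heisPiX l).mpr ⟨i, hd⟩⟩
    · have hy : x * (iotaM l)⁻¹ ∈ EM l := by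
        refine ⟨?_, (mem_heisPiX l).mpr ⟨0 - i, ?_⟩⟩
        · change (Phi l (x * (iotaM l)⁻¹)).left = 1
          rw [map_mul, map_inv, Phi_iotaM, SemidirectProduct.mul_left, hx, one_mul, SemidirectProduct.inv_left,
            SemidirectProduct.left_inr, inv_one, map_one, map_one]
        · rw [map_mul, map_inv, Phi_iotaM, SemidirectProduct.mul_right, SemidirectProduct.inv_right,
            SemidirectProduct.right_inr, hd, DihedralGroup.inv_sr, DihedralGroup.sr_mul_sr]
      rw [← inv_mul_cancel_right x (iotaM l)]
      exact Subgroup.mul_mem _ (Subgroup.mem_sup_left (Subgroup.mem_sup_right hy))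
        (Subgroup.mem_sup_right (Subgroup.mem_zpowers _))

omit [NeZero l] in
/-- `(heisD ⊔ heisTheta) = heisB0`: `⟨(0,c), d⟩ = ⟨(0,c), 1⟩ · ⟨1, d⟩`. (toy bookkeeping) [cite: MochizukiEtTh2009, Def 2.1 p.36] -/
theorem heisD_sup_heisTheta : heisD l ⊔ heisTheta l = heisB0 l := by
  haveI := heisTheta_normal l
  refine le_antisymm (sup_le (heisD_le_heisB0 l) (heisTheta_le_heisB0 l)) fun x hx => ?_
  rw [Subgroup.mem_sup_of_normal_right]
  refine ⟨SemidirectProduct.inr x.right, inr_mem_heisD l _, (SemidirectProduct.inr x.right)⁻¹ * x, ?_,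
    mul_inv_cancel_left _ _⟩
  refine (mem_heisTheta l).mpr ⟨?_, ?_⟩
  · rw [SemidirectProduct.mul_right, SemidirectProduct.inv_right, SemidirectProduct.right_inr, inv_mul_cancel]
  · rw [β_mul, β_inv, β_inr, (mem_heisB0 l).mp hx]; simp

variable (hl : Odd l)

/-- `Π^tp_{C̲̲} = PhiT⁻¹(heisD)`. (toy bookkeeping for [EtTh] Def. 2.5; no claim about print) [cite: MochizukiEtTh2009, Def 2.5 p.39] -/
theorem tp_PiCuu : (monodromyModel l hl).tp (monodromyModel l hl).PiCuu = (heisD l).comap (PhiT l) := by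
  change (PiCuuM l).comap (toHat l).toMonoidHom = _
  rw [PiCuuM_eq, comap_toHat_comap_Phi]

/-- `Π^tp_X = PhiT⁻¹(heisPiX)`. (toy bookkeeping for [EtTh] Def. 2.5; no claim about print) [cite: MochizukiEtTh2009, Def 2.5 p.39] -/
theorem tp_PiX : (monodromyModel l hl).tp (monodromyModel l hl).PiX = (heisPiX l).comap (PhiT l) :=
  comap_toHat_comap_Phi l _

/-- `Π^tp_{X̲̲} = PhiT⁻¹(heisD ∩ heisPiX)`. (toy bookkeeping for [EtTh] Def. 2.5; no claim about print) [cite: MochizukiEtTh2009, Def 2.5 p.39] -/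
theorem tp_PiXuu : (monodromyModel l hl).tp (monodromyModel l hl).PiXuu = (heisD l ⊓ heisPiX l).comap (PhiT l) := by
  change (PiCuuM l ⊓ (heisPiX l).comap (Phi l)).comap (toHat l).toMonoidHom = _
  rw [PiCuuM_eq, ← Subgroup.comap_inf, comap_toHat_comap_Phi]

/-- `Π^tp_{X̲} = PhiT⁻¹(heisB0 ∩ heisPiX)`. (toy bookkeeping for [EtTh] Def. 2.5; no claim about print) [cite: MochizukiEtTh2009, Def 2.5 p.39] -/
theorem tp_PiXu : (monodromyModel l hl).tp (monodromyModel l hl).PiXu = (heisB0 l ⊓ heisPiX l).comap (PhiT l) := by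
  change ((PiCuuM l ⊓ (heisPiX l).comap (Phi l)) ⊔ (heisTheta l).comap (Phi l)).comap (toHat l).toMonoidHom = _
  rw [PiCuuM_eq, ← Subgroup.comap_inf, Subgroup.comap_sup_eq (Phi l) _ _ (Phi_surjective l),
    heisD_inf_heisPiX_sup_heisTheta, comap_toHat_comap_Phi]

/-- `Π^tp_{C̲} = PhiT⁻¹(heisB0)`. (toy bookkeeping for [EtTh] Def. 2.5; no claim about print) [cite: MochizukiEtTh2009, Def 2.5 p.39] -/
theorem tp_PiCu : (monodromyModel l hl).tp (monodromyModel l hl).PiCu = (heisB0 l).comap (PhiT l) := by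
  change (PiCuuM l ⊔ (heisTheta l).comap (Phi l)).comap (toHat l).toMonoidHom = _
  rw [PiCuuM_eq, Subgroup.comap_sup_eq (Phi l) _ _ (Phi_surjective l), heisD_sup_heisTheta, comap_toHat_comap_Phi]

omit [NeZero l] in
/-- Membership in `PhiT⁻¹(heisD)`: `b = c = 0`. (toy bookkeeping) [cite: MochizukiEtTh2009, Def 2.5 p.39] -/
theorem mem_comap_PhiT_heisD {g : TG l} : g ∈ (heisD l).comap (PhiT l) ↔ g.1.left = 1 := Iff.rfl

omit [NeZero l] in
/-- Membership in `PhiT⁻¹(heisB0)`: `b = 0`. (toy bookkeeping) [cite: MochizukiEtTh2009, Def 2.5 p.39] -/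
theorem mem_comap_PhiT_heisB0 {g : TG l} : g ∈ (heisB0 l).comap (PhiT l) ↔ (toAdd g.1.left).1 = 0 := Iff.rfl

end Members

/-! ## 2. Automorphisms of `TG l` -/

/-- The scaling `(b, c) ↦ (u b, u c)` of `(ℤ/l)²` by a unit (it acts on `Δ̄_Θ = {(0, c)}` by `u`). (toy bookkeeping for
[EtTh] Rmk. 2.6.1; no claim about print) [cite: MochizukiEtTh2009, Rmk 2.6.1 p.40] -/
def scale (u : (ZMod l)ˣ) : MulAut (Multiplicative (ZMod l × ZMod l)) where
  toFun x := ofAdd ((u : ZMod l) * (toAdd x).1, (u : ZMod l) * (toAdd x).2)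
  invFun x := ofAdd ((↑u⁻¹ : ZMod l) * (toAdd x).1, (↑u⁻¹ : ZMod l) * (toAdd x).2)
  left_inv x := by
    apply toAdd.injective
    simp only [toAdd_ofAdd, ← mul_assoc, Units.inv_mul, one_mul, Prod.mk.eta]
  right_inv x := by
    apply toAdd.injective
    simp only [toAdd_ofAdd, ← mul_assoc, Units.mul_inv, one_mul, Prod.mk.eta]
  map_mul' x y := by
    apply toAdd.injective
    simp only [toAdd_ofAdd, toAdd_mul, Prod.fst_add, Prod.snd_add, Prod.mk_add_mk, mul_add]

/-- Coordinates of `scale`. (toy bookkeeping) [cite: MochizukiEtTh2009, Rmk 2.6.1 p.40] -/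
@[simp] theorem toAdd_scale (u : (ZMod l)ˣ) (x : Multiplicative (ZMod l × ZMod l)) :
    toAdd (scale l u x) = ((u : ZMod l) * (toAdd x).1, (u : ZMod l) * (toAdd x).2) := rfl

/-- The scaling commutes with the `D_∞`-action. (toy bookkeeping) [cite: MochizukiEtTh2009, Rmk 2.6.1 p.40] -/
theorem scale_thetaInf (u : (ZMod l)ˣ) (d : DihedralGroup 0) (x : Multiplicative (ZMod l × ZMod l)) :
    scale l u (thetaInf l d x) = thetaInf l d (scale l u x) := by
  apply toAdd.injective
  refine Prod.ext ?_ ?_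
  · simp only [toAdd_scale, thetaInf_apply, toAdd_theta_fst]
    ring
  · simp only [toAdd_scale, thetaInf_apply, toAdd_theta_fst, toAdd_theta_snd]
    ring

/-- **`scaleAut u ∈ Aut(TG l)`**: `((b, c), d, e) ↦ ((ub, uc), d, e)`. (toy bookkeeping for [EtTh] Rmk. 2.6.1 «`Aut_K`
contains `μ_l`»; no claim about print) [cite: MochizukiEtTh2009, Rmk 2.6.1 p.40] -/
def scaleAut (u : (ZMod l)ˣ) : TG l ≃* TG l :=
  MulEquiv.prodCongr
    (SemidirectProduct.congr (scale l u) (MulEquiv.refl _) (fun d => MulEquiv.ext fun x => scale_thetaInf l u d x))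
    (MulEquiv.refl _)

/-- Coordinates of `scaleAut`. (toy bookkeeping) [cite: MochizukiEtTh2009, Rmk 2.6.1 p.40] -/
@[simp] theorem scaleAut_apply (u : (ZMod l)ˣ) (g : TG l) :
    scaleAut l u g = ((⟨scale l u g.1.left, g.1.right⟩ : TG₀ l), g.2) := rfl

/-- The shift `sr i ↦ sr (i + k)`, `r i ↦ r i` of a dihedral group (for `D_∞` and `k` odd an OUTER automorphism).
(toy bookkeeping for [EtTh] Prop. 2.6; no claim about print) [cite: MochizukiEtTh2009, Prop 2.6 p.40] -/
def dihedralShift {n : ℕ} (k : ZMod n) : DihedralGroup n ≃* DihedralGroup n where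
  toFun g := match g with
    | DihedralGroup.r i => DihedralGroup.r i
    | DihedralGroup.sr i => DihedralGroup.sr (i + k)
  invFun g := match g with
    | DihedralGroup.r i => DihedralGroup.r i
    | DihedralGroup.sr i => DihedralGroup.sr (i - k)
  left_inv g := by rcases g with i | i <;> simp
  right_inv g := by rcases g with i | i <;> simp
  map_mul' g h := by
    rcases g with i | i <;> rcases h with j | j <;>
      simp only [DihedralGroup.r_mul_r, DihedralGroup.r_mul_sr, DihedralGroup.sr_mul_r, DihedralGroup.sr_mul_sr] <;>
      first | rfl | (congr 1; ring)

/-- `dihedralShift` on a rotation. (toy bookkeeping) [cite: MochizukiEtTh2009, Prop 2.6 p.40] -/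
@[simp] theorem dihedralShift_r {n : ℕ} (k i : ZMod n) : dihedralShift k (DihedralGroup.r i) = DihedralGroup.r i := rfl

/-- `dihedralShift` on a reflection. (toy bookkeeping) [cite: MochizukiEtTh2009, Prop 2.6 p.40] -/
@[simp] theorem dihedralShift_sr {n : ℕ} (k i : ZMod n) :
    dihedralShift k (DihedralGroup.sr i) = DihedralGroup.sr (i + k) := rfl

/-- `2` is a unit in `ℤ/l` for odd `l`. (toy bookkeeping) [cite: MochizukiEtTh2009, Prop 2.6 p.40] -/
def twoUnit (hl : Odd l) : (ZMod l)ˣ :=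
  ZMod.unitOfCoprime 2 (Nat.coprime_two_left.mpr hl)

/-- `(twoUnit : ℤ/l) = 2`. (toy bookkeeping) [cite: MochizukiEtTh2009, Prop 2.6 p.40] -/
@[simp] theorem coe_twoUnit (hl : Odd l) : ((twoUnit l hl : (ZMod l)ˣ) : ZMod l) = 2 := by
  simp [twoUnit]

/-- The compensating shear `(b, c) ↦ (b, c − (k/2) b)` of the half-shift. (toy bookkeeping) [cite: MochizukiEtTh2009, Prop 2.6 p.40] -/
def halfShear (hl : Odd l) (k : ZMod 0) : MulAut (Multiplicative (ZMod l × ZMod l)) :=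
  act l 1 (-(ZMod.castHom (dvd_zero l) (ZMod l) k * ↑(twoUnit l hl)⁻¹))

/-- The half-shift is compatible with the `D_∞`-action: `shear(θ(d) x) = θ(shift d)(shear x)`. (toy bookkeeping)
[cite: MochizukiEtTh2009, Prop 2.6 p.40] -/
theorem halfShear_thetaInf (hl : Odd l) (k : ZMod 0) (d : DihedralGroup 0) (x : Multiplicative (ZMod l × ZMod l)) :
    halfShear l hl k (thetaInf l d x) = thetaInf l (dihedralShift k d) (halfShear l hl k x) := by
  have h2 : (2 : ZMod l) * ↑(twoUnit l hl)⁻¹ = 1 := by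
    rw [← coe_twoUnit l hl, Units.mul_inv]
  apply toAdd.injective
  rcases d with i | i
  · simp only [halfShear, thetaInf_apply, dihedralRed_r, dihedralShift_r, theta_r, Prod.ext_iff, toAdd_act_fst,
      toAdd_act_snd, Units.val_one, one_mul, true_and]
    ring
  · simp only [halfShear, thetaInf_apply, dihedralRed_sr, dihedralShift_sr, theta_sr, Prod.ext_iff, toAdd_act_fst,
      toAdd_act_snd, Units.val_one, Units.val_neg, one_mul, neg_mul, map_add, true_and]
    linear_combination ((toAdd x).1 * (ZMod.castHom (dvd_zero l) (ZMod l) k)) * h2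

/-- **`halfShift k ∈ Aut(TG l)`**: `sr i ↦ sr (i + k)` on `D_∞`, the shear `(b, c) ↦ (b, c − (k/2) b)` on `(ℤ/l)²`,
`e` fixed (for `k = 2j` this is conjugation by `t^{-j}` up to the shear's normalisation; for odd `k` it is OUTER).
(toy bookkeeping for [EtTh] Prop. 2.6; no claim about print) [cite: MochizukiEtTh2009, Prop 2.6 p.40] -/
def halfShift (hl : Odd l) (k : ZMod 0) : TG l ≃* TG l :=
  MulEquiv.prodCongr
    (SemidirectProduct.congr (halfShear l hl k) (dihedralShift k)
      (fun d => MulEquiv.ext fun x => halfShear_thetaInf l hl k d x))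
    (MulEquiv.refl _)

/-- Coordinates of `halfShift`. (toy bookkeeping) [cite: MochizukiEtTh2009, Prop 2.6 p.40] -/
@[simp] theorem halfShift_apply (hl : Odd l) (k : ZMod 0) (g : TG l) :
    halfShift l hl k g = ((⟨halfShear l hl k g.1.left, dihedralShift k g.1.right⟩ : TG₀ l), g.2) := rfl

/-- `halfShear` fixes the elements with `b = 0`. (toy bookkeeping) [cite: MochizukiEtTh2009, Prop 2.6 p.40] -/
theorem halfShear_of_fst_eq_zero (hl : Odd l) (k : ZMod 0) (x : Multiplicative (ZMod l × ZMod l))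
    (hx : (toAdd x).1 = 0) : halfShear l hl k x = x := by
  apply toAdd.injective
  simp only [halfShear, Prod.ext_iff, toAdd_act_fst, toAdd_act_snd, hx, Units.val_one, mul_zero, add_zero,
    and_self]

/-- **`sheetTwist χ ∈ Aut(TG l)`**: `((v, d), e) ↦ ((v, d), e · χ(v, d))` for a character `χ` of `(ℤ/l)² ⋊ D_∞` with
values in `ℤ/2` (e.g. the rotation parity: `t ↦ e t`; the reflection parity: `ι ↦ e ι`). (toy bookkeeping for [EtTh]
Prop. 2.4; no claim about print) [cite: MochizukiEtTh2009, Prop 2.4 p.38] -/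
def sheetTwist (χ : TG₀ l →* Multiplicative (ZMod 2)) : TG l ≃* TG l where
  toFun g := (g.1, g.2 * χ g.1)
  invFun g := (g.1, g.2 * χ g.1)
  left_inv g := by
    refine Prod.ext rfl ?_
    change g.2 * χ g.1 * χ g.1 = g.2
    have h2 : ∀ y : Multiplicative (ZMod 2), y * y = 1 := by decide
    rw [mul_assoc, h2, mul_one]
  right_inv g := by
    refine Prod.ext rfl ?_
    change g.2 * χ g.1 * χ g.1 = g.2
    have h2 : ∀ y : Multiplicative (ZMod 2), y * y = 1 := by decide
    rw [mul_assoc, h2, mul_one]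
  map_mul' g h := by
    refine Prod.ext rfl ?_
    change g.2 * h.2 * χ (g.1 * h.1) = g.2 * χ g.1 * (h.2 * χ h.1)
    rw [map_mul]
    exact mul_mul_mul_comm _ _ _ _

/-- Coordinates of `sheetTwist`. (toy bookkeeping) [cite: MochizukiEtTh2009, Prop 2.4 p.38] -/
@[simp] theorem sheetTwist_apply (χ : TG₀ l →* Multiplicative (ZMod 2)) (g : TG l) :
    sheetTwist l χ g = (g.1, g.2 * χ g.1) := rfl

/-! ## 3. Coordinates `(b, c, d, e)` on `TG l` and the embedding `ℤ/l × D_∞ ↪ TG l` -/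

/-- The `b`-coordinate of `g = (((b, c), d), e) ∈ TG l` (it is `β` of the shadow). (toy bookkeeping) [cite: MochizukiEtTh2009, Def 2.5 p.39] -/
def bC (g : TG l) : ZMod l := (toAdd g.1.left).1

/-- The `c`-coordinate of `g = (((b, c), d), e) ∈ TG l` (it is `γ` of the shadow). (toy bookkeeping) [cite: MochizukiEtTh2009, Def 2.5 p.39] -/
def cC (g : TG l) : ZMod l := (toAdd g.1.left).2

/-- `b = β ∘ sh₀`. (toy bookkeeping) [cite: MochizukiEtTh2009, Def 2.5 p.39] -/
theorem bC_eq (g : TG l) : bC l g = β l (sh₀ l g.1) := rfl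

/-- `c = γ ∘ sh₀`. (toy bookkeeping) [cite: MochizukiEtTh2009, Def 2.5 p.39] -/
theorem cC_eq (g : TG l) : cC l g = γ l (sh₀ l g.1) := rfl

/-- Cocycle rule for `b`: `b(gh) = b(g) + ε(d_g) b(h)`. (toy bookkeeping) [cite: MochizukiEtTh2009, Def 2.5 p.39] -/
@[simp] theorem bC_mul (g h : TG l) : bC l (g * h) = bC l g + eps l (dihedralRed l g.1.right) * bC l h := by
  rw [bC_eq, bC_eq, bC_eq, show (g * h).1 = g.1 * h.1 from rfl, map_mul, β_mul, sh₀_right]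

/-- Cocycle rule for `c`: `c(gh) = c(g) + c(h) + i(d_g) b(h)`. (toy bookkeeping) [cite: MochizukiEtTh2009, Def 2.5 p.39] -/
@[simp] theorem cC_mul (g h : TG l) :
    cC l (g * h) = cC l g + (cC l h + rotIdx l (dihedralRed l g.1.right) * bC l h) := by
  rw [cC_eq, cC_eq, cC_eq, bC_eq, show (g * h).1 = g.1 * h.1 from rfl, map_mul, γ_mul, sh₀_right]

/-- `b` of an inverse. (toy bookkeeping) [cite: MochizukiEtTh2009, Def 2.5 p.39] -/
@[simp] theorem bC_inv (g : TG l) : bC l g⁻¹ = -(eps l (dihedralRed l g.1.right) * bC l g) := by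
  rw [bC_eq, bC_eq, show (g⁻¹).1 = g.1⁻¹ from rfl, map_inv, β_inv, sh₀_right]

/-- `c` of an inverse. (toy bookkeeping) [cite: MochizukiEtTh2009, Def 2.5 p.39] -/
@[simp] theorem cC_inv (g : TG l) :
    cC l g⁻¹ = -cC l g - rotIdx l (dihedralRed l g.1.right)⁻¹ * bC l g := by
  rw [cC_eq, cC_eq, bC_eq, show (g⁻¹).1 = g.1⁻¹ from rfl, map_inv, γ_inv, sh₀_right]

/-- The `D_∞`-component is multiplicative. (toy bookkeeping) [cite: MochizukiEtTh2009, Def 2.5 p.39] -/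
@[simp] theorem right_mul (g h : TG l) : (g * h).1.right = g.1.right * h.1.right := rfl

/-- The `D_∞`-component of an inverse. (toy bookkeeping) [cite: MochizukiEtTh2009, Def 2.5 p.39] -/
@[simp] theorem right_inv (g : TG l) : (g⁻¹).1.right = g.1.right⁻¹ := rfl

/-- The `ℤ/2`-component is multiplicative. (toy bookkeeping) [cite: MochizukiEtTh2009, Def 2.5 p.39] -/
@[simp] theorem snd_mul (g h : TG l) : (g * h).2 = g.2 * h.2 := rfl

/-- The `ℤ/2`-component of an inverse. (toy bookkeeping) [cite: MochizukiEtTh2009, Def 2.5 p.39] -/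
@[simp] theorem snd_inv (g : TG l) : (g⁻¹).2 = g.2⁻¹ := rfl

/-- An element of `TG l` is determined by its coordinates `(b, c, d, e)`. (toy bookkeeping) [cite: MochizukiEtTh2009, Def 2.5 p.39] -/
theorem TG.ext {g h : TG l} (h1 : g.1.right = h.1.right) (h2 : bC l g = bC l h) (h3 : cC l g = cC l h)
    (h4 : g.2 = h.2) : g = h :=
  Prod.ext (SemidirectProduct.ext (toAdd.injective (Prod.ext h2 h3)) h1) h4

/-- **`embCu : ℤ/l × D_∞ ↪ TG l`, `(c, d) ↦ (((0, c), d), 1)`** — a homomorphism because `D_∞` fixes `Δ̄_Θ = {(0, c)}`;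
its image is `Π^tp_{Ċ̲} = {b = 0, e = 1}`, and it restricts to `D_∞ ≅ Π^tp_{Ċ̲̲}`, `ℤ/l × ⟨t⟩ ≅ Π^tp_{Ẋ̲}`, `⟨t⟩ ≅ Π^tp_{Ẋ̲̲}`
(Rmk. 2.6.1's shapes). (toy bookkeeping for [EtTh] Rmk. 2.6.1; no claim about print) [cite: MochizukiEtTh2009, Rmk 2.6.1 p.40] -/
def embCu : Multiplicative (ZMod l) × DihedralGroup 0 →* TG l where
  toFun p := ((⟨ofAdd (0, toAdd p.1), p.2⟩ : TG₀ l), 1)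
  map_one' := rfl
  map_mul' p q := by
    refine TG.ext l rfl ?_ ?_ (mul_one _).symm
    · rw [bC_mul]
      change (0 : ZMod l) = 0 + eps l (dihedralRed l p.2) * 0
      rw [mul_zero, add_zero]
    · rw [cC_mul]
      change toAdd (p.1 * q.1) = toAdd p.1 + (toAdd q.1 + rotIdx l (dihedralRed l p.2) * 0)
      rw [mul_zero, add_zero, toAdd_mul]

/-- Coordinates of `embCu`. (toy bookkeeping) [cite: MochizukiEtTh2009, Rmk 2.6.1 p.40] -/
@[simp] theorem embCu_right (p : Multiplicative (ZMod l) × DihedralGroup 0) : (embCu l p).1.right = p.2 := rfl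

/-- Coordinates of `embCu`. (toy bookkeeping) [cite: MochizukiEtTh2009, Rmk 2.6.1 p.40] -/
@[simp] theorem bC_embCu (p : Multiplicative (ZMod l) × DihedralGroup 0) : bC l (embCu l p) = 0 := rfl

/-- Coordinates of `embCu`. (toy bookkeeping) [cite: MochizukiEtTh2009, Rmk 2.6.1 p.40] -/
@[simp] theorem cC_embCu (p : Multiplicative (ZMod l) × DihedralGroup 0) : cC l (embCu l p) = toAdd p.1 := rfl

/-- Coordinates of `embCu`. (toy bookkeeping) [cite: MochizukiEtTh2009, Rmk 2.6.1 p.40] -/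
@[simp] theorem embCu_snd (p : Multiplicative (ZMod l) × DihedralGroup 0) : (embCu l p).2 = 1 := rfl

/-- `embCu` is injective. (toy bookkeeping) [cite: MochizukiEtTh2009, Rmk 2.6.1 p.40] -/
theorem embCu_injective : Function.Injective (embCu l) := by
  intro p q h
  exact Prod.ext (toAdd.injective (by simpa using congrArg (cC l) h)) (by simpa using congrArg (fun g : TG l => g.1.right) h)

/-- The element `x^a := (((a, 0), 1), 1) ∈ TG l` (a lift of the `a`-cycle). (toy bookkeeping for [EtTh] Prop. 2.6; no claim
about print) [cite: MochizukiEtTh2009, Prop 2.6 p.40] -/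
def xElt (a : ZMod l) : TG l := ((SemidirectProduct.inl (ofAdd (a, 0)) : TG₀ l), 1)

/-- Coordinates of `x^a`. (toy bookkeeping) [cite: MochizukiEtTh2009, Prop 2.6 p.40] -/
@[simp] theorem xElt_right (a : ZMod l) : (xElt l a).1.right = 1 := rfl

/-- Coordinates of `x^a`. (toy bookkeeping) [cite: MochizukiEtTh2009, Prop 2.6 p.40] -/
@[simp] theorem bC_xElt (a : ZMod l) : bC l (xElt l a) = a := rfl

/-- Coordinates of `x^a`. (toy bookkeeping) [cite: MochizukiEtTh2009, Prop 2.6 p.40] -/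
@[simp] theorem cC_xElt (a : ZMod l) : cC l (xElt l a) = 0 := rfl

/-- Coordinates of `x^a`. (toy bookkeeping) [cite: MochizukiEtTh2009, Prop 2.6 p.40] -/
@[simp] theorem xElt_snd (a : ZMod l) : (xElt l a).2 = 1 := rfl

/-- **Conjugation by `x^a` is the twist `t ↦ z^{-a} t` on `Π^tp_{Ẋ̲}`**: for a rotation `d = r^i`,
`x^a · ((0,c), r^i) · x^{-a} = ((0, c − i a), r^i)`. (toy bookkeeping for [EtTh] Prop. 2.6; no claim about print)
[cite: MochizukiEtTh2009, Prop 2.6 p.40] -/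
theorem conj_xElt_embCu_r (a c : ZMod l) (i : ZMod 0) :
    xElt l a * embCu l (ofAdd c, DihedralGroup.r i) * (xElt l a)⁻¹ =
      embCu l (ofAdd (c - ZMod.castHom (dvd_zero l) (ZMod l) i * a), DihedralGroup.r i) := by
  refine TG.ext l ?_ ?_ ?_ (by simp)
  · simp
  · simp
  · simp
    ring

/-- Coordinates of `ι = s`. (toy bookkeeping) [cite: MochizukiEtTh2009, Prop 2.2 p.37] -/
@[simp] theorem iotaT_coords :
    (iotaT l).1.right = DihedralGroup.sr 0 ∧ bC l (iotaT l) = 0 ∧ cC l (iotaT l) = 0 ∧ (iotaT l).2 = 1 :=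
  ⟨rfl, rfl, rfl, rfl⟩

/-- Coordinates of `scaleAut u g`: `(ub, uc, d, e)`. (toy bookkeeping) [cite: MochizukiEtTh2009, Rmk 2.6.1 p.40] -/
@[simp] theorem scaleAut_coords (u : (ZMod l)ˣ) (g : TG l) :
    (scaleAut l u g).1.right = g.1.right ∧ bC l (scaleAut l u g) = u * bC l g ∧
      cC l (scaleAut l u g) = u * cC l g ∧ (scaleAut l u g).2 = g.2 :=
  ⟨rfl, rfl, rfl, rfl⟩

/-- Coordinates of `halfShift k g`: `(b, c − (k/2) b, shift_k d, e)`. (toy bookkeeping) [cite: MochizukiEtTh2009, Prop 2.6 p.40] -/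
@[simp] theorem halfShift_coords (hl : Odd l) (k : ZMod 0) (g : TG l) :
    (halfShift l hl k g).1.right = dihedralShift k g.1.right ∧ bC l (halfShift l hl k g) = bC l g ∧
      cC l (halfShift l hl k g) = cC l g + -(ZMod.castHom (dvd_zero l) (ZMod l) k * ↑(twoUnit l hl)⁻¹) * bC l g ∧
      (halfShift l hl k g).2 = g.2 := by
  refine ⟨rfl, ?_, rfl, rfl⟩
  change ((1 : (ZMod l)ˣ) : ZMod l) * bC l g = bC l g
  rw [Units.val_one, one_mul]

/-- Coordinates of `sheetTwist χ g`: `(b, c, d, e·χ)`. (toy bookkeeping) [cite: MochizukiEtTh2009, Prop 2.4 p.38] -/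
@[simp] theorem sheetTwist_coords (χ : TG₀ l →* Multiplicative (ZMod 2)) (g : TG l) :
    (sheetTwist l χ g).1.right = g.1.right ∧ bC l (sheetTwist l χ g) = bC l g ∧
      cC l (sheetTwist l χ g) = cC l g ∧ (sheetTwist l χ g).2 = g.2 * χ g.1 :=
  ⟨rfl, rfl, rfl, rfl⟩

end Literature.AnabelianGeometry.EtaleTheta.ThetaCovers.MonodromyModel

end
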